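import Literature.Algebra.Homology.GroupCohomologyGoodCoverFinite
import Literature.Algebra.Homology.GroupCohomologyInvariantsNilpotent
import HarnessLib

/-!
# Brown's finiteness criterion from an equivariant good cover indexed by a free `G`-set

Topic `Algebra/Homology`; namespace `Literature.Algebra.Homology`.  Theorems only (no definition,
no named fact, no `sorry`); a thin wrapper over
`Literature/Algebra/Homology/GroupCohomologyGoodCoverFinite`.

Let a group `G` act on a CONTRACTIBLE space `X` and on an index set `ι`, and let
`𝔘 = (U_i)_{i ∈ ι}` be an open cover with `g U_i = U_{g i}` all of whose non-empty finite
intersections are contractible (an equivariant good cover).  Assume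

* the action of `G` on `ι` is FREE (`g i = i ⇒ g = 1`), and
* in each degree `p` finitely many tuples `J₀ : Fin (p+1) → ι` have translates `g J₀` exhausting
  the `p`-simplices of the nerve `N_p(𝔘)` (finitely many orbits of simplices).

Then the nerve `N_p(𝔘)` is a free `G`-set (`Nerve.eq_one_of_smul_eq`) with finitely many orbits
(`Nerve.finite_orbitRelQuotient`), so — decomposing it along the section `Quotient.out` of its
orbits (`bijective_smul_out` of `Literature/Algebra/Homology/GroupCohomologyInvariantsNilpotent`)
— `Fun(N_p, A) ≅ Coind_1^G Fun(N_p/G, A)` has finite cohomology for `A` finite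
(`finite_groupCohomology_funRep_of_free`, Shapiro's lemma), and the exact Čech coresolution
`0 → A → Fun(N₀, A) → Fun(N₁, A) → ⋯` gives, by dimension shifting
(`finite_groupCohomology_of_invariantGoodCover`, [Brown1982CohomologyGroups, VII (7.10), VIII §2];
exactness is Leray's theorem for a good cover [BottTu1982Forms, Thm. 15.8]):
**`Hⁿ(G, A)` is finite for every representation `A` of `G` with finitely many elements and every
`n`** (`finite_groupCohomology_of_free_equivariantGoodCover`, universe-polymorphic over a
commutative coefficient ring `k`; `finite_groupCohomology_int_of_free_equivariantGoodCover`, the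
`Type`/`ℤ` instance).  No torsion-freeness of `G`, no freeness of the action on `X` and no
compactness of a quotient are needed.

## References

* K. S. Brown, *Cohomology of Groups*, GTM 87 (1982), VII §4, VII (7.10), VIII §2
  [Brown1982CohomologyGroups].
* R. Bott, L. W. Tu, *Differential Forms in Algebraic Topology*, GTM 82 (1982), §8, Thm. 15.8
  [BottTu1982Forms].
-/

noncomputable section

open CategoryTheory groupCohomology
open Literature.AlgebraicTopology.SingularHomology
open Literature.AlgebraicTopology.SingularHomology.CechNerve
open scoped Pointwise

universe u

namespace Literature.Algebra.Homology

variable {G : Type u} [Group G]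

/-! ### The nerve of an invariant family indexed by a free `G`-set -/

section Nerve

variable {X : Type u} [MulAction G X] {ι : Type u} [MulAction G ι] (U : ι → Set X)

/-- An invariant family in image form, `g '' U_i = U_{g i}`, is an `IsInvariantFamily`.
[folklore] -/
theorem isInvariantFamily_of_image_eq
    (hUG : ∀ (g : G) (i : ι), (fun x : X => g • x) '' U i = U (g • i)) :
    IsInvariantFamily G U :=
  ⟨fun g i => by rw [← Set.image_smul]; exact (hUG g i).symm⟩

variable [IsInvariantFamily G U]

/-- **The nerve of an invariant family indexed by a free `G`-set is a free `G`-set**: `g • J = J`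
forces `g • J(0) = J(0)`. [folklore] -/
theorem Nerve.eq_one_of_smul_eq (hfree : ∀ (g : G) (i : ι), g • i = i → g = 1) (p : ℕ) :
    ∀ (g : G) (J : Nerve U p), g • J = J → g = 1 := fun g J h =>
  hfree g (J.1 0) (by
    have h0 := congrArg (fun K : Nerve U p => K.1 0) h
    change (g • J.1) 0 = J.1 0 at h0
    rwa [Pi.smul_apply] at h0)

/-- **Finitely many orbits of simplices**: if finitely many tuples have translates exhausting the
`p`-simplices of the nerve, the orbit quotient `N_p(𝔘)/G` is finite. [folklore] -/
theorem Nerve.finite_orbitRelQuotient {p : ℕ} {S : Set (Fin (p + 1) → ι)} (hS : S.Finite)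
    (hSN : ∀ J : Fin (p + 1) → ι, (cechSet U J).Nonempty → ∃ J₀ ∈ S, ∃ g : G, g • J₀ = J) :
    Finite (MulAction.orbitRel.Quotient G (Nerve U p)) := by
  haveI : Finite ↥{J₀ : Fin (p + 1) → ι | J₀ ∈ S ∧ (cechSet U J₀).Nonempty} :=
    (hS.subset fun _ h => h.1).to_subtype
  refine Finite.of_surjective
    (fun J₀ : ↥{J₀ : Fin (p + 1) → ι | J₀ ∈ S ∧ (cechSet U J₀).Nonempty} =>
      (⟦(⟨J₀.1, J₀.2.2⟩ : Nerve U p)⟧ : MulAction.orbitRel.Quotient G (Nerve U p))) ?_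
  intro x
  induction x using Quotient.inductionOn with
  | h J =>
    obtain ⟨J₀, hJ₀S, g, hg⟩ := hSN J.1 J.2
    have hJ₀ : (g⁻¹ • J).1 = J₀ := by
      rw [Nerve.coe_smul, ← hg, inv_smul_smul]
    have hne : (cechSet U J₀).Nonempty := hJ₀ ▸ (g⁻¹ • J).2
    refine ⟨⟨J₀, hJ₀S, hne⟩, ?_⟩
    have he : (⟨J₀, hne⟩ : Nerve U p) = g⁻¹ • J := Subtype.ext hJ₀.symm
    change (⟦(⟨J₀, hne⟩ : Nerve U p)⟧ : MulAction.orbitRel.Quotient G (Nerve U p)) = ⟦J⟧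
    rw [he]
    exact Quotient.sound (MulAction.orbitRel_apply.2 (MulAction.mem_orbit J g⁻¹))

end Nerve

/-! ### The finiteness criterion -/

/-- **Brown's finiteness criterion from an equivariant good cover indexed by a free `G`-set with
finitely many orbits of simplices** (coefficients in any commutative ring `k`).  Let `G` act on a
contractible space `X` covered by open sets `U_i` indexed by a FREE `G`-set `ι`, with
`g U_i = U_{g i}`, all non-empty finite intersections contractible, and finitely many `G`-orbits
of `p`-simplices of the nerve for each `p`.  Then `Hⁿ(G, A)` is finite for every representation
`A` with finitely many elements: the nerve is a free `G`-set with finitely many orbits in each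
degree, decomposed as `G × N_p/G ≃ N_p` by the section `Quotient.out` (`bijective_smul_out`), so
`Hⁿ(G, Fun(N_p, A))` is finite (`finite_groupCohomology_funRep_of_free`), and the exact Čech
coresolution gives the claim by dimension shifting (`finite_groupCohomology_of_invariantGoodCover`).
[cite: Brown1982CohomologyGroups, VII (7.10); VIII §2] -/
theorem finite_groupCohomology_of_free_equivariantGoodCover
    {X : Type u} [TopologicalSpace X] [ContractibleSpace X]
    {ι : Type u} [MulAction G ι] [MulAction G X]
    (U : ι → Set X) (hUo : ∀ i, IsOpen (U i)) (hcov : Set.univ ⊆ ⋃ i, U i)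
    (hgood : ∀ (p : ℕ) (J : Fin (p + 1) → ι),
      (cechSet U J).Nonempty → ContractibleSpace ↥(cechSet U J))
    (hUG : ∀ (g : G) (i : ι), (fun x : X => g • x) '' U i = U (g • i))
    (hfree : ∀ (g : G) (i : ι), g • i = i → g = 1)
    (hfin : ∀ p : ℕ, ∃ S : Set (Fin (p + 1) → ι), S.Finite ∧
      ∀ J : Fin (p + 1) → ι, (cechSet U J).Nonempty → ∃ J₀ ∈ S, ∃ g : G, g • J₀ = J)
    {k : Type u} [CommRing k] (A : Rep.{u} k G) [Finite A] (n : ℕ) :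
    Finite (groupCohomology A n) := by
  haveI : IsInvariantFamily G U := isInvariantFamily_of_image_eq U hUG
  refine finite_groupCohomology_of_invariantGoodCover U A hUo hcov hgood (fun p m => ?_) n
  obtain ⟨S, hS, hSN⟩ := hfin p
  haveI := Nerve.finite_orbitRelQuotient (G := G) U hS hSN
  -- `bijective_smul_out` decomposes a free `G`-set as `N_p/G × G`; swap the factors.
  exact finite_groupCohomology_funRep_of_free A (Nerve U p)
    (fun a : MulAction.orbitRel.Quotient G (Nerve U p) => a.out)
    ((bijective_smul_out (Nerve.eq_one_of_smul_eq U hfree p)).comp Prod.swap_bijective) m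

/-- **Brown's finiteness criterion from an equivariant good cover indexed by a free `G`-set with
finitely many orbits of simplices** — integral coefficients, all types in `Type`: for a group `G`
acting on a contractible space `X` with an equivariant open good cover `(U_i)_{i ∈ ι}` indexed by
a free `G`-set, finitely many orbits of nerve simplices in each degree, and a `ℤ[G]`-module `A`
with finitely many elements, every `Hⁿ(G, A)` is finite.
[cite: Brown1982CohomologyGroups, VII (7.10); VIII §2] -/
theorem finite_groupCohomology_int_of_free_equivariantGoodCover
    {X : Type} [TopologicalSpace X] [ContractibleSpace X]
    {G : Type} [Group G] {ι : Type} [MulAction G ι] [MulAction G X]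
    (U : ι → Set X) (hUo : ∀ i, IsOpen (U i)) (hcov : Set.univ ⊆ ⋃ i, U i)
    (hgood : ∀ (p : ℕ) (J : Fin (p + 1) → ι),
      (cechSet U J).Nonempty → ContractibleSpace ↥(cechSet U J))
    (hUG : ∀ (g : G) (i : ι), (fun x : X => g • x) '' U i = U (g • i))
    (hfree : ∀ (g : G) (i : ι), g • i = i → g = 1)
    (hfin : ∀ p : ℕ, ∃ S : Set (Fin (p + 1) → ι), S.Finite ∧
      ∀ J : Fin (p + 1) → ι, (cechSet U J).Nonempty → ∃ J₀ ∈ S, ∃ g : G, g • J₀ = J)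
    (A : Rep ℤ G) (hA : Finite A) (n : ℕ) : Finite (groupCohomology A n) := by
  haveI := hA
  exact finite_groupCohomology_of_free_equivariantGoodCover U hUo hcov hgood hUG hfree hfin A n

end Literature.Algebra.Homology
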